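import Mathlib
import HarnessLib
import Summits.NavierStokesRegularity.NavierStokesRegularity.Theorems.PoloidalWindowRigidity.Negative.TriSheetProfile
import Summits.NavierStokesRegularity.NavierStokesRegularity.Theorems.PoloidalWindowRigidity.Negative.TriWaveGauge

/-!
# Crux `PoloidalWindowRigidity` (K2, stmt-NavierStokesRegularity-19708) — negative side:
# the no-source-gauge clause holds for the three-sheet profile

Negative-side support (refuter seat ns-regularity-refuter1 gen 2; D-0081 §C), sequel of `…Negative.TriSheetProfile`,
reusing the generic pieces of `…Negative.GaugeClauseDrift` / `…Negative.TriWaveGauge`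
(`eq_of_fderiv_horizontal_eq_zero`, `hasDerivAt_cellAmp_neg_one`, `hasDerivAt_log_neg_neg_one`,
`differentiable_slice_of_contDiffOn_slab`, `laplacian_comp_add_const`).

`ψ₀ = 2v₂` is a stream function of the horizontal vorticity of `v = sheetProfile`; every `C²` stream function is
`ψ₀ + g(t,x₂)`.  The three-sheet field has no period, so the comparison of `…Negative.TriWaveGauge` is replaced by
a PARITY argument on the slice `t = −1` (`Ψ = ψ(−1,·)`, `S` odd): the function `K(y) = Ψ(y) + Ψ(−y)` depends on
the height only and is even, so its differential vanishes on the plane `{y₂ = 0}` and its Laplacian is constant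
there; hence for `z` in that plane the advection terms of the source at `z` and `−z` cancel and the Laplacian terms
add up to a constant, while the gauge part of `∂ₜψ` is the same at all points of the plane.  What is left of
`2·Src(0) − Src(Y) − Src(−Y)`, `Y = (1/3)e₁`, is the even part of `∂ₜψ₀`: `∂ₜψ₀(−1, b e₁) = 2β(b) + (2b−4)β′(b)`
is `−8` at `b = 0` and `±2B` at `b = ±1/3` (`β′(±1/3) = 0`), so the combination is `−16 ≠ 0`.  Hence
`noSourceGauge_sheetProfile` (clause (16) of S2⁗, even without its slope hypotheses).

WHAT THIS IS NOT: not a claim about Navier–Stokes — kinematics of an explicit profile. [folklore]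
-/

noncomputable section

-- the summit and its single sub-problem share the name (CONVENTIONS §1), as in every Theorems file
set_option linter.dupNamespace false

namespace Summit.NavierStokesRegularity.NavierStokesRegularity.Theorems.PoloidalWindowRigidity.Negative

open MeasureTheory Set Function Filter Topology Metric
open scoped RealInnerProductSpace InnerProductSpace ENNReal NNReal Laplacian
open Literature.Analysis Literature.Analysis.FluidPDE

/-! ## The stream function `ψ₀ = 2v₂` -/

/-- Derivative of `x ↦ 2 v₂(t,x)`. [folklore] -/
theorem hasFDerivAt_two_mul_sheetProfile_two (t : ℝ) (y : EuclideanSpace ℝ (Fin 3)) :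
    HasFDerivAt (fun x : EuclideanSpace ℝ (Fin 3) => 2 * sheetProfile t x 2)
      ((2 : ℝ) • ((EuclideanSpace.proj (2 : Fin 3) : EuclideanSpace ℝ (Fin 3) →L[ℝ] ℝ).comp
        (fderiv ℝ (sheetProfile t) y))) y := by
  have hd : HasFDerivAt (sheetProfile t) (fderiv ℝ (sheetProfile t) y) y :=
    (hasFDerivAt_sheetProfile t y).differentiableAt.hasFDerivAt
  exact ((EuclideanSpace.proj (2 : Fin 3) : EuclideanSpace ℝ (Fin 3) →L[ℝ] ℝ).hasFDerivAt.comp y hd).const_mul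
    (2 : ℝ)

/-- `D(2v₂)(t,y) w = 2 (−t)^{-1} DS₂(A_t y) w`. [folklore] -/
theorem fderiv_two_mul_sheetProfile_two (t : ℝ) (y w : EuclideanSpace ℝ (Fin 3)) :
    fderiv ℝ (fun x : EuclideanSpace ℝ (Fin 3) => 2 * sheetProfile t x 2) y w =
      2 * (cellAmp t ^ 2 * sheetDeriv (driftShift t y) w 2) := by
  rw [(hasFDerivAt_two_mul_sheetProfile_two t y).fderiv]
  simp [fderiv_sheetProfile_apply]

/-- `ψ₀ = 2v₂` is a stream function of the horizontal vorticity: `curl v 0 = ∂₁ψ₀`, `curl v 1 = −∂₀ψ₀`. [folklore] -/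
theorem stream_two_mul_sheetProfile_two (t : ℝ) (y : EuclideanSpace ℝ (Fin 3)) :
    curl (sheetProfile t) y 0 = fderiv ℝ (fun x : EuclideanSpace ℝ (Fin 3) => 2 * sheetProfile t x 2) y
        (EuclideanSpace.single (1 : Fin 3) (1 : ℝ)) ∧
      curl (sheetProfile t) y 1 = -fderiv ℝ (fun x : EuclideanSpace ℝ (Fin 3) => 2 * sheetProfile t x 2) y
          (EuclideanSpace.single (0 : Fin 3) (1 : ℝ)) := by
  rw [fderiv_two_mul_sheetProfile_two, fderiv_two_mul_sheetProfile_two, curl_sheetProfile_apply_zero,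
    curl_sheetProfile_apply_one, sheetDeriv_apply_two, sheetDeriv_apply_two]
  constructor
  · simp; ring
  · simp; ring

/-- Every `C²` stream function of the horizontal vorticity of `v` differs from `ψ₀ = 2v₂` by a function of
`(t, x₂)` only. [folklore] -/
theorem stream_sub_two_mul_sheetProfile_two_dependsOnHeight {ψ : ℝ → EuclideanSpace ℝ (Fin 3) → ℝ}
    (hψ : ContDiffOn ℝ 2 (uncurry ψ) (Iio (0 : ℝ) ×ˢ univ))
    (hstr : ∀ t < 0, ∀ y, curl (sheetProfile t) y 0 = fderiv ℝ (ψ t) y (EuclideanSpace.single (1 : Fin 3) (1 : ℝ)) ∧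
      curl (sheetProfile t) y 1 = -fderiv ℝ (ψ t) y (EuclideanSpace.single (0 : Fin 3) (1 : ℝ)))
    {t : ℝ} (ht : t < 0) {x x' : EuclideanSpace ℝ (Fin 3)} (hx : x 2 = x' 2) :
    ψ t x - 2 * sheetProfile t x 2 = ψ t x' - 2 * sheetProfile t x' 2 := by
  have hd1 : Differentiable ℝ (ψ t) := differentiable_slice_of_contDiffOn_slab hψ ht
  have hd2 : Differentiable ℝ (fun x : EuclideanSpace ℝ (Fin 3) => 2 * sheetProfile t x 2) :=
    fun y => (hasFDerivAt_two_mul_sheetProfile_two t y).differentiableAt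
  have hsub : ∀ y w, fderiv ℝ (fun x => ψ t x - 2 * sheetProfile t x 2) y w =
      fderiv ℝ (ψ t) y w - fderiv ℝ (fun x : EuclideanSpace ℝ (Fin 3) => 2 * sheetProfile t x 2) y w := by
    intro y w
    have h : HasFDerivAt (fun x => ψ t x - 2 * sheetProfile t x 2)
        (fderiv ℝ (ψ t) y - fderiv ℝ (fun x : EuclideanSpace ℝ (Fin 3) => 2 * sheetProfile t x 2) y) y :=
      (hd1 y).hasFDerivAt.sub (hd2 y).hasFDerivAt
    rw [h.fderiv, sub_apply]
  refine eq_of_fderiv_horizontal_eq_zero (φ := fun x => ψ t x - 2 * sheetProfile t x 2) (hd1.sub hd2)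
    (fun y => ?_) (fun y => ?_) hx
  · rw [hsub]
    linarith [(hstr t ht y).2, (stream_two_mul_sheetProfile_two t y).2]
  · rw [hsub]
    linarith [(hstr t ht y).1, (stream_two_mul_sheetProfile_two t y).1]

/-- `ψ₀(τ, b e₁) = 4 c_τ β(c_τ b + log(−τ))` (`c_τ = (−τ)^{-1/2}`). [folklore] -/
theorem two_mul_sheetProfile_two_axisPoint (τ b : ℝ) :
    2 * sheetProfile τ (b • (EuclideanSpace.single (1 : Fin 3) (1 : ℝ))) 2 =
      4 * (cellAmp τ * oddBump (cellAmp τ * b + Real.log (-τ))) := by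
  simp [sheetProfile, sheetField_apply_two, driftShift_apply_zero, driftShift_apply_one, driftShift_apply_two,
    oddBump_zero]
  ring

/-- `∂ₜψ₀(−1, b e₁) = 2β(b) + (2b − 4)β′(b)`. [folklore] -/
theorem hasDerivAt_two_mul_sheetProfile_two_axisPoint (b : ℝ) :
    HasDerivAt (fun τ : ℝ => 2 * sheetProfile τ (b • (EuclideanSpace.single (1 : Fin 3) (1 : ℝ))) 2)
      (2 * oddBump b + (2 * b - 4) * oddBumpDeriv b) (-1) := by
  have f : (fun τ : ℝ => 2 * sheetProfile τ (b • (EuclideanSpace.single (1 : Fin 3) (1 : ℝ))) 2) =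
      fun τ => 4 * (cellAmp τ * oddBump (cellAmp τ * b + Real.log (-τ))) := by
    funext τ
    exact two_mul_sheetProfile_two_axisPoint τ b
  have hc := hasDerivAt_cellAmp_neg_one
  have hin : HasDerivAt (fun τ : ℝ => cellAmp τ * b + Real.log (-τ)) (1 / 2 * b + (-1)) (-1) :=
    (hc.mul_const b).add hasDerivAt_log_neg_neg_one
  have hβ := (hasDerivAt_oddBump (cellAmp (-1) * b + Real.log (-(-1)))).comp (-1) hin
  rw [f]
  refine ((hc.mul hβ).const_mul 4).congr_deriv ?_
  simp [cellAmp_neg_one]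
  ring

/-! ## Parity -/

/-- `S` is odd. [folklore] -/
theorem sheetField_neg (x : EuclideanSpace ℝ (Fin 3)) : sheetField (-x) = -sheetField x := by
  have h0 : (-x) 0 + (-x) 2 = -(x 0 + x 2) := by simp; ring
  have h1 : (-x) 1 - (-x) 2 = -(x 1 - x 2) := by simp; ring
  have h2 : (-x) 1 + (-x) 2 = -(x 1 + x 2) := by simp; ring
  ext i
  fin_cases i
  · show sheetField (-x) 0 = (-sheetField x) 0
    rw [PiLp.neg_apply, sheetField_apply_zero, sheetField_apply_zero, h0, oddBump_neg]
  · show sheetField (-x) 1 = (-sheetField x) 1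
    rw [PiLp.neg_apply, sheetField_apply_one, sheetField_apply_one, h1, h2, oddBump_neg, oddBump_neg]
    ring
  · show sheetField (-x) 2 = (-sheetField x) 2
    rw [PiLp.neg_apply, sheetField_apply_two, sheetField_apply_two, h0, h1, h2, oddBump_neg, oddBump_neg,
      oddBump_neg]
    ring

/-- Reflection invariance of the Laplacian: `Δ(f(−·))(x) = (Δf)(−x)`. [folklore] -/
theorem laplacian_comp_neg {F : Type*} [NormedAddCommGroup F] [NormedSpace ℝ F]
    (f : EuclideanSpace ℝ (Fin 3) → F) (x : EuclideanSpace ℝ (Fin 3)) :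
    (Δ (fun y => f (-y))) x = (Δ f) (-x) := by
  rw [InnerProductSpace.laplacian_eq_iteratedFDeriv_stdOrthonormalBasis,
    InnerProductSpace.laplacian_eq_iteratedFDeriv_stdOrthonormalBasis]
  refine Finset.sum_congr rfl fun i _ => ?_
  have hf : (fun y => f (-y)) = f ∘ (ContinuousLinearEquiv.neg ℝ : EuclideanSpace ℝ (Fin 3) ≃L[ℝ]
      EuclideanSpace ℝ (Fin 3)) := by
    funext y
    simp
  have h := (ContinuousLinearEquiv.neg ℝ : EuclideanSpace ℝ (Fin 3) ≃L[ℝ] EuclideanSpace ℝ (Fin 3))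
    |>.iteratedFDerivWithin_comp_right f uniqueDiffOn_univ (Set.mem_univ _) 2 (x := x)
  rw [Set.preimage_univ, iteratedFDerivWithin_univ, iteratedFDerivWithin_univ] at h
  rw [hf, h, ContinuousMultilinearMap.compContinuousLinearMap_apply]
  have hv : (fun j : Fin 2 => ((ContinuousLinearEquiv.neg ℝ : EuclideanSpace ℝ (Fin 3) ≃L[ℝ]
      EuclideanSpace ℝ (Fin 3)) : EuclideanSpace ℝ (Fin 3) →L[ℝ] EuclideanSpace ℝ (Fin 3))
        (![stdOrthonormalBasis ℝ (EuclideanSpace ℝ (Fin 3)) i, stdOrthonormalBasis ℝ (EuclideanSpace ℝ (Fin 3)) i]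
          j)) = fun j => (-1 : ℝ) • ![stdOrthonormalBasis ℝ (EuclideanSpace ℝ (Fin 3)) i,
            stdOrthonormalBasis ℝ (EuclideanSpace ℝ (Fin 3)) i] j := by
    funext j
    simp
  rw [ContinuousLinearEquiv.neg_apply, hv, ContinuousMultilinearMap.map_smul_univ]
  simp

/-! ## The no-source-gauge clause -/

/-- **The no-source-gauge clause (16) holds for the three-sheet profile**, even without its slope hypotheses: no
`C²` stream function of the horizontal vorticity of `v` has a source depending on `t` only. [folklore] -/
theorem noSourceGauge_sheetProfile (ψ : ℝ → EuclideanSpace ℝ (Fin 3) → ℝ) (src : ℝ → ℝ)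
    (hψ : ContDiffOn ℝ 2 (uncurry ψ) (Iio (0 : ℝ) ×ˢ univ))
    (hstr : ∀ t < 0, ∀ y, curl (sheetProfile t) y 0 = fderiv ℝ (ψ t) y (EuclideanSpace.single (1 : Fin 3) (1 : ℝ)) ∧
      curl (sheetProfile t) y 1 = -fderiv ℝ (ψ t) y (EuclideanSpace.single (0 : Fin 3) (1 : ℝ))) :
    ∃ t < 0, ∃ x, deriv (fun τ => ψ τ x) t + fderiv ℝ (ψ t) x (sheetProfile t x) - (Δ (ψ t)) x ≠ src t := by
  by_contra hcon
  push Not at hcon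
  have hm1 : (-1 : ℝ) < 0 := by norm_num
  -- ## the three comparison points `O = 0`, `Y = (1/3)e₁`, `Y' = −Y` of the plane `{x₂ = 0}`
  set O : EuclideanSpace ℝ (Fin 3) := (0 : ℝ) • (EuclideanSpace.single (1 : Fin 3) (1 : ℝ)) with hO
  set Y : EuclideanSpace ℝ (Fin 3) := (1 / 3 : ℝ) • (EuclideanSpace.single (1 : Fin 3) (1 : ℝ)) with hY
  set Y' : EuclideanSpace ℝ (Fin 3) := (-(1 / 3) : ℝ) • (EuclideanSpace.single (1 : Fin 3) (1 : ℝ)) with hY'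
  have hO0 : O = 0 := by rw [hO, zero_smul]
  have hYY' : Y' = -Y := by rw [hY, hY', neg_smul]
  have hO2 : O 2 = 0 := by simp [hO]
  have hY2 : Y 2 = O 2 := by simp [hY, hO]
  have hY'2 : Y' 2 = O 2 := by simp [hY', hO]
  -- ## (1) time derivatives: the gauge part `h(τ) = ψ τ O − ψ₀ τ O` is the same at `Y`, `Y'` (same height)
  have hψO : DifferentiableAt ℝ (fun τ : ℝ => ψ τ O) (-1) := by
    have hopen : IsOpen (Iio (0 : ℝ) ×ˢ (univ : Set (EuclideanSpace ℝ (Fin 3)))) := isOpen_Iio.prod isOpen_univ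
    have h1 : DifferentiableAt ℝ (uncurry ψ) ((-1 : ℝ), O) :=
      (hψ.differentiableOn (by norm_num)).differentiableAt (hopen.mem_nhds ⟨by norm_num, trivial⟩)
    have h2 : DifferentiableAt ℝ (fun τ : ℝ => ((τ, O) : ℝ × EuclideanSpace ℝ (Fin 3))) (-1) :=
      differentiableAt_id.prodMk (differentiableAt_const O)
    exact h1.comp (-1) h2
  have hh : DifferentiableAt ℝ (fun τ : ℝ => ψ τ O - 2 * sheetProfile τ O 2) (-1) :=
    hψO.sub (hasDerivAt_two_mul_sheetProfile_two_axisPoint 0).differentiableAt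
  have eT : ∀ b : ℝ, ((b • (EuclideanSpace.single (1 : Fin 3) (1 : ℝ)) : EuclideanSpace ℝ (Fin 3)) 2 = O 2) →
      deriv (fun τ => ψ τ (b • (EuclideanSpace.single (1 : Fin 3) (1 : ℝ)))) (-1) =
        (2 * oddBump b + (2 * b - 4) * oddBumpDeriv b) + deriv (fun τ : ℝ => ψ τ O - 2 * sheetProfile τ O 2) (-1) := by
    intro b hb
    have hev : (fun τ => ψ τ (b • (EuclideanSpace.single (1 : Fin 3) (1 : ℝ)))) =ᶠ[𝓝 (-1 : ℝ)]
        fun τ => 2 * sheetProfile τ (b • (EuclideanSpace.single (1 : Fin 3) (1 : ℝ))) 2 +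
          (ψ τ O - 2 * sheetProfile τ O 2) := by
      filter_upwards [Iio_mem_nhds hm1] with τ hτ
      have := stream_sub_two_mul_sheetProfile_two_dependsOnHeight hψ hstr hτ hb
      linarith
    rw [hev.deriv_eq]
    exact ((hasDerivAt_two_mul_sheetProfile_two_axisPoint b).add hh.hasDerivAt).deriv
  have eTO := eT 0 rfl
  have eTY := eT (1 / 3) hY2
  have eTY' := eT (-(1 / 3)) hY'2
  rw [oddBump_zero, oddBumpDeriv_zero] at eTO
  rw [oddBump_third, oddBumpDeriv_third] at eTY
  rw [oddBump_neg_third, oddBumpDeriv_neg_third] at eTY'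
  -- the source identity at the three points, time derivatives evaluated
  have h1 := hcon (-1) hm1 O
  have h2 := hcon (-1) hm1 Y
  have h3 := hcon (-1) hm1 Y'
  rw [hO] at h1
  rw [eTO, ← hO] at h1
  rw [hY] at h2
  rw [eTY, ← hY] at h2
  rw [hY'] at h3
  rw [eTY', ← hY'] at h3
  rw [sheetProfile_neg_one] at h1 h2 h3
  -- ## (2) the slice `Ψ = ψ(−1, ·)` and the even function `K(y) = Ψ(y) + Ψ(−y)`
  set Ψ : EuclideanSpace ℝ (Fin 3) → ℝ := ψ (-1) with hΨ
  have hΨd : Differentiable ℝ Ψ := differentiable_slice_of_contDiffOn_slab hψ hm1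
  have hΨ2 : ∀ x, ContDiffAt ℝ 2 Ψ x := by
    intro x
    have hopen : IsOpen (Iio (0 : ℝ) ×ˢ (univ : Set (EuclideanSpace ℝ (Fin 3)))) := isOpen_Iio.prod isOpen_univ
    have h1 : ContDiffAt ℝ 2 (uncurry ψ) ((-1 : ℝ), x) := hψ.contDiffAt (hopen.mem_nhds ⟨hm1, trivial⟩)
    have h2 : ContDiffAt ℝ 2 (fun y : EuclideanSpace ℝ (Fin 3) => ((-1 : ℝ), y)) x :=
      contDiffAt_const.prodMk contDiffAt_id
    exact h1.comp x h2
  have hdep : ∀ y y' : EuclideanSpace ℝ (Fin 3), y 2 = y' 2 →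
      Ψ y - 2 * sheetField y 2 = Ψ y' - 2 * sheetField y' 2 := by
    intro y y' hyy
    have h := stream_sub_two_mul_sheetProfile_two_dependsOnHeight hψ hstr hm1 hyy
    simpa only [sheetProfile_neg_one] using h
  set K : EuclideanSpace ℝ (Fin 3) → ℝ := fun y => Ψ y + Ψ (-y) with hK
  -- `K` is invariant under horizontal translations …
  have hKh : ∀ y a : EuclideanSpace ℝ (Fin 3), a 2 = 0 → K (y + a) = K y := by
    intro y a ha
    have e1 : (y + a) 2 = y 2 := by simp [ha]
    have e2 : (-(y + a)) 2 = (-y) 2 := by simp [ha]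
    have h1 := hdep _ _ e1
    have h2 := hdep _ _ e2
    have s1 : sheetField (-(y + a)) 2 = -sheetField (y + a) 2 := by rw [sheetField_neg, PiLp.neg_apply]
    have s2 : sheetField (-y) 2 = -sheetField y 2 := by rw [sheetField_neg, PiLp.neg_apply]
    simp only [hK]
    linarith
  -- … and even
  have hKe : ∀ y : EuclideanSpace ℝ (Fin 3), K (-y) = K y := by
    intro y
    simp only [hK, neg_neg]
    ring
  have hnegd : Differentiable ℝ (fun y : EuclideanSpace ℝ (Fin 3) => -y) := differentiable_id.neg
  have hKd : Differentiable ℝ K := hΨd.add (hΨd.comp hnegd)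
  -- the differential of `K` vanishes on the plane `{y₂ = 0}`
  have hKD : ∀ z : EuclideanSpace ℝ (Fin 3), z 2 = 0 → ∀ w : EuclideanSpace ℝ (Fin 3), fderiv ℝ K z w = 0 := by
    intro z hz w
    -- directional derivatives along lines
    have hline : ∀ a : EuclideanSpace ℝ (Fin 3),
        HasDerivAt (fun s : ℝ => K (z + s • a)) (fderiv ℝ K z a) 0 := by
      intro a
      have hl : HasDerivAt (fun s : ℝ => z + s • a) ((1 : ℝ) • a) 0 :=
        ((hasDerivAt_id (0 : ℝ)).smul_const a).const_add z
      have h := (hKd z).hasFDerivAt.comp_hasDerivAt_of_eq 0 hl (by simp)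
      rw [one_smul] at h
      exact h
    -- horizontal directions: the line function is constant
    have hhor : ∀ a : EuclideanSpace ℝ (Fin 3), a 2 = 0 → fderiv ℝ K z a = 0 := by
      intro a ha
      have hconst : (fun s : ℝ => K (z + s • a)) = fun _ => K z := by
        funext s
        exact hKh z (s • a) (by simp [ha])
      have h1 := hline a
      rw [hconst] at h1
      exact h1.unique (hasDerivAt_const _ _)
    -- the vertical direction: the line function is even
    have hver : fderiv ℝ K z (EuclideanSpace.single (2 : Fin 3) (1 : ℝ)) = 0 := by
      set φ : ℝ → ℝ := fun s => K (z + s • EuclideanSpace.single (2 : Fin 3) (1 : ℝ)) with hφ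
      have heven : (fun s => φ (-s)) = φ := by
        funext s
        simp only [hφ]
        have hv : -(z + (-s) • EuclideanSpace.single (2 : Fin 3) (1 : ℝ)) =
            (z + s • EuclideanSpace.single (2 : Fin 3) (1 : ℝ)) + (-2 : ℝ) • z := by
          ext i
          fin_cases i <;> simp <;> ring
        rw [← hKe, hv, hKh (z + s • EuclideanSpace.single (2 : Fin 3) (1 : ℝ)) ((-2 : ℝ) • z) (by simp [hz])]
      have hd : deriv φ 0 = fderiv ℝ K z (EuclideanSpace.single (2 : Fin 3) (1 : ℝ)) := (hline _).deriv
      have h0 : deriv φ 0 = -deriv φ 0 := by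
        conv_lhs => rw [← heven]
        rw [deriv_comp_neg, neg_zero]
      rw [← hd]
      linarith
    have hw : w = w 0 • EuclideanSpace.single (0 : Fin 3) (1 : ℝ) + w 1 • EuclideanSpace.single (1 : Fin 3) (1 : ℝ) +
        w 2 • EuclideanSpace.single (2 : Fin 3) (1 : ℝ) := by
      ext i
      fin_cases i <;> simp
    rw [hw, map_add, map_add, map_smul, map_smul, map_smul, hhor (EuclideanSpace.single (0 : Fin 3) (1 : ℝ)) (by simp),
      hhor (EuclideanSpace.single (1 : Fin 3) (1 : ℝ)) (by simp), hver]
    simp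
  -- ## (3) advection: the terms at `z` and `−z` cancel, the term at `O = 0` vanishes
  have hΨneg : ∀ z w : EuclideanSpace ℝ (Fin 3), fderiv ℝ (fun y => Ψ (-y)) z w = -fderiv ℝ Ψ (-z) w := by
    intro z w
    have h : HasFDerivAt (fun y => Ψ (-y)) ((fderiv ℝ Ψ (-z)).comp
        ((ContinuousLinearEquiv.neg ℝ : EuclideanSpace ℝ (Fin 3) ≃L[ℝ] EuclideanSpace ℝ (Fin 3)) :
          EuclideanSpace ℝ (Fin 3) →L[ℝ] EuclideanSpace ℝ (Fin 3))) z :=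
      ((hΨd (-z)).hasFDerivAt).comp z
        ((ContinuousLinearEquiv.neg ℝ : EuclideanSpace ℝ (Fin 3) ≃L[ℝ] EuclideanSpace ℝ (Fin 3)).hasFDerivAt)
    rw [h.fderiv]
    simp
  have hadv : fderiv ℝ Ψ Y (sheetField Y) + fderiv ℝ Ψ Y' (sheetField Y') = 0 := by
    have h := hKD Y (by simp [hY]) (sheetField Y)
    have hKf : fderiv ℝ K Y (sheetField Y) = fderiv ℝ Ψ Y (sheetField Y) + fderiv ℝ (fun y => Ψ (-y)) Y
        (sheetField Y) := by
      have hd : HasFDerivAt K (fderiv ℝ Ψ Y + fderiv ℝ (fun y => Ψ (-y)) Y) Y :=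
        (hΨd Y).hasFDerivAt.add ((hΨd.comp hnegd) Y).hasFDerivAt
      rw [hd.fderiv]
      rfl
    rw [hKf, hΨneg] at h
    rw [hYY', sheetField_neg, map_neg]
    linarith
  have hadvO : fderiv ℝ Ψ O (sheetField O) = 0 := by
    rw [hO0, show sheetField 0 = 0 from ?_, map_zero]
    ext i
    fin_cases i <;> simp [sheetField_apply_zero, sheetField_apply_one, sheetField_apply_two, oddBump_zero]
  -- ## (4) Laplacians: `ΔΨ(z) + ΔΨ(−z) = ΔK(z)` is constant on the plane
  have hlapK : ∀ z : EuclideanSpace ℝ (Fin 3), (Δ K) z = (Δ Ψ) z + (Δ Ψ) (-z) := by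
    intro z
    have h1 : ContDiffAt ℝ 2 (fun y => Ψ (-y)) z := (hΨ2 (-z)).comp z contDiff_neg.contDiffAt
    have h := (hΨ2 z).laplacian_add h1
    rw [laplacian_comp_neg] at h
    exact h
  have hlapOY : (Δ K) O = (Δ K) Y := by
    have hinv : (fun y => K (y + Y)) = K := by
      funext y
      exact hKh y Y (by simp [hY])
    have h := laplacian_comp_add_const K Y O
    rw [hinv, hO0, zero_add] at h
    rw [hO0]
    exact h
  -- ## (5) the combination `2·Src(O) − Src(Y) − Src(Y')`
  have hnegO : -O = O := by rw [hO0, neg_zero]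
  have hKO := hlapK O
  have hKY := hlapK Y
  rw [hnegO] at hKO
  rw [← hYY'] at hKY
  rw [hadvO] at h1
  linarith [bumpMax_pos]

end Summit.NavierStokesRegularity.NavierStokesRegularity.Theorems.PoloidalWindowRigidity.Negative

end
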